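import Mathlib.Analysis.Analytic.IsolatedZeros
import Mathlib.Analysis.Analytic.Uniqueness
import Mathlib.Analysis.Analytic.Constructions
import Mathlib.Analysis.Analytic.Linear
import Mathlib.MeasureTheory.Constructions.Pi
import Mathlib.MeasureTheory.Measure.Prod
import Mathlib.MeasureTheory.Measure.Lebesgue.Basic
import Literature.Analysis.Calculus.RealAnalyticZeroSet
import HarnessLib

/-!
# The zero set of a real analytic function is Lebesgue-null — proof

Topic `Literature/Analysis/Calculus`. This file DISCHARGES the named fact
`Literature.Analysis.Calculus.realAnalytic_zeroSet_null` of `RealAnalyticZeroSet.lean`: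

* `realAnalytic_zeroSet_null_holds : realAnalytic_zeroSet_null` — for `A` real analytic on a
  connected open `U ⊆ ℝ^d` (`EuclideanSpace ℝ (Fin d)`) and not identically zero,
  `volume {x ∈ U | A x = 0} = 0` [Mityagin2015, Proposition 1] (B. Mityagin, *The zero set of a
  real analytic function*, arXiv:1512.07276; Math. Notes 107 (2020) 529–530).

## The argument, and where it deviates from the printed one

Mityagin's two-claim proof (Claim 2: `{B = 0, ∇B ≠ 0}` is null by the implicit function theorem;
Claim 3: `{A = 0} ⊆ ⋃_t {∂ᵗA = 0, ∇∂ᵗA ≠ 0}` by finite order of vanishing) needs two pieces of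
plumbing Mathlib (this pin) does not offer in usable form: multi-index partial derivatives of a
real analytic function as analytic functions whose simultaneous vanishing at a point forces the
germ to vanish, and "a `C¹` hypersurface piece is Lebesgue-null". The note itself (p. 1) records
the classical alternative "from using Fubini's theorem to Hironaka's resolution of singularities"
([Kuchment, Remark 5.23], [Dang, Lemma 1.2] as cited there); we formalize the **Fubini induction
on `d`**, which Mathlib supports directly:

1. `Mityagin2015.volume_zeroSet_null_real` — `d = 1`: on a preconnected set the zeros of a not
   identically vanishing analytic `g : ℝ → ℝ` are isolated
   (`AnalyticAt.eventually_eq_zero_or_eventually_ne_zero` + the identity principle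
   `AnalyticOnNhd.eqOn_zero_of_preconnected_of_eventuallyEq_zero`), hence the zero set is
   locally a singleton and null (`measure_null_of_locally_null`).
2. `Mityagin2015.volume_zeroSet_null_cube` — induction on `d` for sup-metric balls (= open cubes)
   in `Fin d → ℝ`: split `ℝ^{d+1} = ℝ × ℝ^d` measure-preservingly
   (`volume_preserving_piFinSuccAbove`), note that the parameters `t` whose slice function
   `y ↦ A (t, y)` vanishes identically on the cube lie in the zero set of the one-variable
   analytic function `t ↦ A (t, tail x₀)` (`x₀` a point with `A x₀ ≠ 0`), which is null by 1.,
   and conclude with `Measure.measure_prod_null` and the induction hypothesis on every other slice.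
3. `Mityagin2015.volume_zeroSet_null_pi` — connected open `U ⊆ (Fin d → ℝ)`: by the identity
   principle `A` is not identically zero on any ball inside `U`, so 2. applies locally, and
   `measure_null_of_locally_null` globalizes.
4. `realAnalytic_zeroSet_null_holds` — transport to `EuclideanSpace ℝ (Fin d)` along the
   volume-preserving measurable equivalence `WithLp.toLp / WithLp.ofLp`
   (`EuclideanSpace.volume_preserving_symm_measurableEquiv_toLp`), analyticity being preserved by
   the continuous linear equivalence `PiLp.continuousLinearEquiv`.

Deliberately NOT here: Mityagin's Proposition 4 (`dim_H {A = 0} ≤ d - 1`) and the quasi-analytic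
(Denjoy–Carleman) extension of his closing remark.

## References

* B. Mityagin, *The zero set of a real analytic function*, arXiv:1512.07276; Mat. Zametki /
  Math. Notes 107 (2020), 529–530, doi:10.1134/s0001434620030189. [Mityagin2015]
-/

open MeasureTheory Set Filter
open scoped Topology

noncomputable section

namespace Literature.Analysis.Calculus

namespace Mityagin2015

/-! ### Measurability and the one-dimensional case -/

/-- The zero set `{x ∈ U | A x = 0}` of a function continuous on an open set `U` is measurable
(it is `U` minus the relatively open set `{x ∈ U | A x ≠ 0}`). [folklore] -/
theorem measurableSet_zeroSet_of_continuousOn {X : Type*} [TopologicalSpace X]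
    [MeasurableSpace X] [OpensMeasurableSpace X] {U : Set X} {A : X → ℝ} (hU : IsOpen U)
    (hA : ContinuousOn A U) : MeasurableSet {x ∈ U | A x = 0} := by
  have h1 : IsOpen (U ∩ A ⁻¹' {0}ᶜ) := hA.isOpen_inter_preimage hU isOpen_compl_singleton
  have h2 : {x ∈ U | A x = 0} = U ∩ (U ∩ A ⁻¹' {0}ᶜ)ᶜ := by
    ext x
    simp only [mem_setOf_eq, mem_inter_iff, mem_preimage, mem_compl_iff, mem_singleton_iff]
    tauto
  rw [h2]
  exact hU.measurableSet.inter h1.measurableSet.compl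

/-- **Dimension one.** If `g : ℝ → ℝ` is analytic at every point of a preconnected set `I` and
does not vanish identically on `I`, then `{t ∈ I | g t = 0}` is Lebesgue-null: by the identity
principle every zero in `I` is isolated, so the zero set is locally contained in a singleton.
[folklore] -/
theorem volume_zeroSet_null_real {g : ℝ → ℝ} {I : Set ℝ} (hI : IsPreconnected I)
    (hg : AnalyticOnNhd ℝ g I) (h0 : ∃ t ∈ I, g t ≠ 0) :
    volume {t ∈ I | g t = 0} = 0 := by
  obtain ⟨t₁, ht₁I, ht₁⟩ := h0
  refine measure_null_of_locally_null _ fun t ht => ?_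
  obtain ⟨htI, -⟩ := ht
  rcases (hg t htI).eventually_eq_zero_or_eventually_ne_zero with h | h
  · exact absurd (hg.eqOn_zero_of_preconnected_of_eventuallyEq_zero hI htI h ht₁I) ht₁
  · obtain ⟨u, hu, hu'⟩ := mem_nhdsWithin_iff_exists_mem_nhds_inter.mp h
    refine ⟨u ∩ {t' ∈ I | g t' = 0}, inter_comm u _ ▸ inter_mem_nhdsWithin _ hu, ?_⟩
    refine measure_mono_null (fun z hz => ?_) (measure_singleton t)
    by_contra hzt
    exact hu' ⟨hz.1, hzt⟩ hz.2.2

/-! ### Splitting off the first coordinate of `Fin (d + 1) → ℝ` -/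

/-- `y ↦ Fin.cons t y` is (affine, hence) analytic. [folklore] -/
theorem analyticAt_cons_right {d : ℕ} (t : ℝ) (y : Fin d → ℝ) :
    AnalyticAt ℝ (fun y' : Fin d → ℝ => (Fin.cons t y' : Fin (d + 1) → ℝ)) y := by
  refine AnalyticAt.pi (f := fun i y' => (Fin.cons t y' : Fin (d + 1) → ℝ) i) fun i => ?_
  refine Fin.cases ?_ (fun j => ?_) i
  · simp only [Fin.cons_zero]
    exact analyticAt_const
  · simp only [Fin.cons_succ]
    exact (ContinuousLinearMap.proj (R := ℝ) j).analyticAt y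

/-- `t ↦ Fin.cons t y` is (affine, hence) analytic. [folklore] -/
theorem analyticAt_cons_left {d : ℕ} (t : ℝ) (y : Fin d → ℝ) :
    AnalyticAt ℝ (fun t' : ℝ => (Fin.cons t' y : Fin (d + 1) → ℝ)) t := by
  refine AnalyticAt.pi (f := fun i t' => (Fin.cons t' y : Fin (d + 1) → ℝ) i) fun i => ?_
  refine Fin.cases ?_ (fun j => ?_) i
  · simp only [Fin.cons_zero]
    exact analyticAt_id
  · simp only [Fin.cons_succ]
    exact analyticAt_const

/-- A sup-metric ball of `Fin (d + 1) → ℝ` is the product of the ball of first coordinates and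
the ball of tails: `Fin.cons t y ∈ B(z, r) ↔ t ∈ B(z 0, r) ∧ y ∈ B(tail z, r)` (`0 < r`).
[folklore] -/
theorem cons_mem_ball_iff {d : ℕ} {z : Fin (d + 1) → ℝ} {r : ℝ} (hr : 0 < r) (t : ℝ)
    (y : Fin d → ℝ) :
    (Fin.cons t y : Fin (d + 1) → ℝ) ∈ Metric.ball z r ↔
      t ∈ Metric.ball (z 0) r ∧ y ∈ Metric.ball (Fin.tail z) r := by
  simp only [Metric.mem_ball, dist_pi_lt_iff hr, Fin.forall_fin_succ, Fin.cons_zero, Fin.cons_succ,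
    Fin.tail]

/-! ### The induction on the dimension (Fubini) -/

/-- **Local statement on cubes, by induction on `d`.** If `A : (Fin d → ℝ) → ℝ` is analytic at
every point of a sup-metric ball `B(z, r)` (an open cube) and `A x₀ ≠ 0` for some `x₀ ∈ B(z, r)`,
then `volume {x ∈ B(z, r) | A x = 0} = 0`. Step `d → d + 1`: split off the first coordinate
measure-preservingly; the parameters `t ∈ B(z 0, r)` whose slice `y ↦ A (Fin.cons t y)` vanishes
on all of `B(tail z, r)` lie in the zero set of the one-variable analytic function
`t ↦ A (Fin.cons t (tail x₀))`, not zero at `t = x₀ 0`, hence form a null set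
(`volume_zeroSet_null_real`); every other slice of the zero set is null by the induction
hypothesis, and `Measure.measure_prod_null` concludes. (The Fubini road to
[Mityagin2015, Proposition 1], cf. the alternatives listed on p. 1 there.) [folklore] -/
theorem volume_zeroSet_null_cube : ∀ (d : ℕ) (z : Fin d → ℝ) (r : ℝ) (A : (Fin d → ℝ) → ℝ),
    (∀ x ∈ Metric.ball z r, AnalyticAt ℝ A x) → (∃ x ∈ Metric.ball z r, A x ≠ 0) →
      volume {x ∈ Metric.ball z r | A x = 0} = 0 := by
  intro d
  induction d with
  | zero =>
    intro z r A _ h0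
    obtain ⟨x₀, -, hA0⟩ := h0
    have : {x ∈ Metric.ball z r | A x = 0} = ∅ := by
      ext x
      simp only [mem_setOf_eq, mem_empty_iff_false, iff_false, not_and]
      intro _
      rwa [Subsingleton.elim x x₀]
    rw [this, measure_empty]
  | succ d ih =>
    intro z r A hA h0
    obtain ⟨x₀, hx₀, hA0⟩ := h0
    have hr : 0 < r := Metric.pos_of_mem_ball hx₀
    set Z := {x ∈ Metric.ball z r | A x = 0} with hZ
    -- split off coordinate `0`: `ℝ^{d+1} ≃ᵐ ℝ × ℝ^d`, measure-preservingly
    set e := MeasurableEquiv.piFinSuccAbove (fun _ : Fin (d + 1) => ℝ) 0 with he_def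
    have he : MeasurePreserving e volume (volume.prod volume) :=
      volume_preserving_piFinSuccAbove (fun _ : Fin (d + 1) => ℝ) 0
    have hes : ∀ (t : ℝ) (y : Fin d → ℝ), e.symm (t, y) = Fin.cons t y := fun t y => by
      simp only [he_def, MeasurableEquiv.piFinSuccAbove_symm_apply, Fin.insertNthEquiv_zero]
      rfl
    have hZm : MeasurableSet Z := measurableSet_zeroSet_of_continuousOn Metric.isOpen_ball
      fun x hx => (hA x hx).continuousAt.continuousWithinAt
    -- head and tail of `x₀` lie in the head ball and the tail ball
    have hx₀' := (cons_mem_ball_iff hr (x₀ 0) (Fin.tail x₀)).mp (by rwa [Fin.cons_self_tail])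
    -- the parameters with identically vanishing slice form a null set
    have hT : volume {t ∈ Metric.ball (z 0) r | A (Fin.cons t (Fin.tail x₀)) = 0} = 0 := by
      refine volume_zeroSet_null_real (convex_ball (z 0) r).isPreconnected (fun t ht => ?_)
        ⟨x₀ 0, hx₀'.1, by rwa [Fin.cons_self_tail]⟩
      exact AnalyticAt.comp (f := fun t' : ℝ => (Fin.cons t' (Fin.tail x₀) : Fin (d + 1) → ℝ))
        (hA _ ((cons_mem_ball_iff hr t _).mpr ⟨ht, hx₀'.2⟩)) (analyticAt_cons_left t (Fin.tail x₀))
    -- Fubini: it suffices that almost every slice of `Z` is null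
    rw [← he.symm.measure_preimage_equiv Z, Measure.measure_prod_null (e.symm.measurable hZm)]
    have hae : ∀ᵐ t : ℝ, t ∉ {t ∈ Metric.ball (z 0) r | A (Fin.cons t (Fin.tail x₀)) = 0} :=
      compl_mem_ae_iff.mpr hT
    filter_upwards [hae] with t ht
    simp only [Pi.zero_apply]
    by_cases htb : t ∈ Metric.ball (z 0) r
    · -- good parameter: the slice function is not identically zero, induction hypothesis
      have hne : A (Fin.cons t (Fin.tail x₀)) ≠ 0 := fun h => ht ⟨htb, h⟩
      have key := ih (Fin.tail z) r (fun y => A (Fin.cons t y))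
        (fun y hy => (hA _ ((cons_mem_ball_iff hr t y).mpr ⟨htb, hy⟩)).comp
          (analyticAt_cons_right t y))
        ⟨Fin.tail x₀, hx₀'.2, hne⟩
      refine measure_mono_null (fun y hy => ?_) key
      simp only [mem_preimage, hes, hZ, mem_setOf_eq, cons_mem_ball_iff hr] at hy
      exact ⟨hy.1.2, hy.2⟩
    · -- parameter outside the head ball: empty slice
      have : Prod.mk t ⁻¹' (e.symm ⁻¹' Z) = ∅ := by
        ext y
        simp only [mem_preimage, hes, hZ, mem_setOf_eq, cons_mem_ball_iff hr, mem_empty_iff_false,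
          iff_false, not_and]
        exact fun h _ => (htb h.1).elim
      rw [this, measure_empty]

/-- **The statement on `Fin d → ℝ`.** For `A` analytic at every point of a preconnected open
`U ⊆ (Fin d → ℝ)` and not identically zero on `U`, `volume {x ∈ U | A x = 0} = 0`: by the identity
principle `A` vanishes identically on no ball inside `U`, so `volume_zeroSet_null_cube` makes the
zero set locally null, and `measure_null_of_locally_null` globalizes. [folklore] -/
theorem volume_zeroSet_null_pi {d : ℕ} {U : Set (Fin d → ℝ)} {A : (Fin d → ℝ) → ℝ}
    (hU : IsOpen U) (hc : IsPreconnected U) (hA : AnalyticOnNhd ℝ A U) (h0 : ∃ x ∈ U, A x ≠ 0) :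
    volume {x ∈ U | A x = 0} = 0 := by
  obtain ⟨x₀, hx₀U, hx₀⟩ := h0
  refine measure_null_of_locally_null _ fun z hz => ?_
  obtain ⟨hzU, -⟩ := hz
  obtain ⟨r, hr, hball⟩ := Metric.isOpen_iff.mp hU z hzU
  have hne : ∃ x ∈ Metric.ball z r, A x ≠ 0 := by
    by_contra h
    push Not at h
    have hfz : A =ᶠ[𝓝 z] 0 := eventually_of_mem (Metric.ball_mem_nhds z hr) h
    exact hx₀ (hA.eqOn_zero_of_preconnected_of_eventuallyEq_zero hc hzU hfz hx₀U)
  refine ⟨{x ∈ Metric.ball z r | A x = 0}, ?_,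
    volume_zeroSet_null_cube d z r A (fun x hx => hA x (hball hx)) hne⟩
  refine mem_nhdsWithin_iff_exists_mem_nhds_inter.mpr
    ⟨Metric.ball z r, Metric.ball_mem_nhds z hr, ?_⟩
  rintro x ⟨hxb, -, hAx⟩
  exact ⟨hxb, hAx⟩

end Mityagin2015

open Mityagin2015 in
/-- **The zero set of a non-trivial real analytic function is Lebesgue-null** — discharge of the
named fact `realAnalytic_zeroSet_null`: for `A` real analytic on a connected open
`U ⊆ EuclideanSpace ℝ (Fin d)` with `A x ≠ 0` for some `x ∈ U`, `volume {x ∈ U | A x = 0} = 0`.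
Proof: transport `Mityagin2015.volume_zeroSet_null_pi` along the volume-preserving measurable
equivalence `EuclideanSpace ℝ (Fin d) ≃ᵐ (Fin d → ℝ)` (`WithLp.ofLp`), under which analyticity,
openness and connectedness are preserved. [cite: Mityagin2015, Proposition 1] -/
theorem realAnalytic_zeroSet_null_holds : realAnalytic_zeroSet_null := by
  intro d U A hU hc hA h0
  set U' : Set (Fin d → ℝ) := (WithLp.toLp 2) ⁻¹' U with hU'
  set A' : (Fin d → ℝ) → ℝ := fun y => A (WithLp.toLp 2 y) with hA'
  have hU'o : IsOpen U' := hU.preimage (PiLp.continuous_toLp 2 _)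
  have hU'c : IsPreconnected U' := by
    have : U' = (WithLp.ofLp) '' U := by
      ext y
      simp only [hU', mem_preimage, mem_image]
      constructor
      · exact fun h => ⟨WithLp.toLp 2 y, h, rfl⟩
      · rintro ⟨x, hx, rfl⟩
        simpa using hx
    rw [this]
    exact hc.isPreconnected.image _ (PiLp.continuous_ofLp 2 _).continuousOn
  have hA'an : AnalyticOnNhd ℝ A' U' := fun y hy =>
    (hA _ hy).comp ((PiLp.continuousLinearEquiv 2 ℝ (fun _ : Fin d => ℝ)).symm.analyticAt y)
  have h0' : ∃ y ∈ U', A' y ≠ 0 := by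
    obtain ⟨x, hxU, hx⟩ := h0
    exact ⟨WithLp.ofLp x, by simpa [hU'] using hxU, by simpa [hA'] using hx⟩
  have key := volume_zeroSet_null_pi hU'o hU'c hA'an h0'
  have hZ : {x ∈ U | A x = 0} =
      (MeasurableEquiv.toLp 2 (Fin d → ℝ)).symm ⁻¹' {y ∈ U' | A' y = 0} := by
    ext x
    simp [hU', hA']
  rw [hZ,
    (EuclideanSpace.volume_preserving_symm_measurableEquiv_toLp (Fin d)).measure_preimage_equiv]
  exact key

end Literature.Analysis.Calculus

end
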